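import Summits.QuantumFields.BalabanUV.T4Continuum.Support.NE3FrameFreeSliceW
import HarnessLib

/-!
# NE3FrameFreeDecompositionW (T⁴ programme, node NE3, row K0b of the owner's ruling ρ-g22-2, file 2∕2) — Φ6-W ON THE SLICE OF RECORD:
# `ker d(avg^k)_W ∩ {skew, periodic} = gaugeDir W (Ξ₀) ⊕ frameFreeBlockLandauW L N k W`, EXISTENCE AND UNIQUENESS, at every
# background of the multi-level small-field class

NE3 (node U1b) formalisation swarm `b2b-balaban-t4-ne3-formalise-*`, leaf seat `b2b-balaban-t4-ne3-formalise-leaf-02` (gen 5), row **K0b**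
(announced `HOME/CLAIMS.log` ≈17:08Z); file 1 = `NE3FrameFreeSliceW` (Ξ₀₀(W), the projection for sub-modules, the Set T_♮(W), S6).  All
[folklore], 0 sorry, 0 def; the class is that of `NE3TangentCovariantTower.dirIter_gaugeDir` (unitary `W` of period `tower L M (j+1)`,
`0 ≤ x`, `LevelSmall d L j x`, `SmallField W x`):
§12 **(U_W) `gaugeDir_eq_zero_of_frameFree_orthogonal`**: a skew periodic corner-trivial `μ` whose direction is frame-free and
   `hsR`-orthogonal to `gaugeDir W (Ξ₀₀(W))` has `gaugeDir W μ = 0` (the curved (‡) `NE3CovariantBlockMean.framePotW_gaugeDir` turns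
   frame-freeness into `bmeanIterW μ = 0`, i.e. `μ ∈ Ξ₀₀(W)`; then `μ` is orthogonal to itself); `gaugeDir_eq_zero_of_mem_frameFreeBlockLandauW`
   — the TRIVIAL INTERSECTION `gaugeDir W (Ξ₀) ∩ T_♮(W) = {0}`;
§13 **(E_W) `exists_cornerGauge_mem_frameFreeBlockLandauW`** (`L^d ≥ 2`): every skew `(tower L M (j+1))`-periodic `Y` with
   `TangentIter L j W Y` has a 𝔲(n)-valued periodic CORNER-TRIVIAL `μ` (`μ ((L^(j+1))•w) = 0`) with
   `(fun y ν => Y y ν + gaugeDir W μ y ν) ∈ frameFreeBlockLandauW L M (j+1) W` — `μ = μ₁ + η`: this seat's curved frame-kill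
   `NE3CurvedFrameKill.exists_frameFreeW_repr`, then the Riesz projection `η ∈ Ξ₀₀(W)` of file 1's `exists_orthogonalW_of_le`; frame-freeness
   survives because `η ∈ Ξ₀₀(W)` ((‡) + `framePotW_add`), tangency by leaf-04's `tangentIter_add_gaugeDir_iff`;
§14 `gaugeDir_sub_fun`, **(D_W) `frameFreeW_decomposition_unique`**: two corner-trivial gauges moving one `Y` into the slice have the same
   direction (linearity + (U_W)).
TOGETHER: the chart's L1 at a curved background ON THE SLICE OF RECORD T_♮(W) (ρ-g22-2 (V3)) — the T_♮ twin of leaf-01-g5's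
`NE3CurvedProjectedLandau` (T_pt(W), p227421).  ROW K0 = K0a + K0b is thereby in the tree up to the owner's K6 socket wiring.
HONEST FRAMING.  Exact linear algebra ∕ kinematics at a fixed background in the small-field class; nothing about Bałaban's minimisers;
(P♮)_W (the curved wall `SlicePoincare`), (ML_w) at `W ≠ 1`, T-E_w and NE3 are NOT proved; spine PROVED 0∕9; finite T⁴ rung (B)+1 — NOT
infinite volume, NOT mass gap, NOT BetaPertH, NOT Clay.  ABSOLUTE RULE kept (context only: [Balaban1985Averaging] (42)–(48) pp. 23–25,
(110)–(125) pp. 31–36; [Balaban1985Variational] (83) p. 290).  PLACEMENT: `Summits/QuantumFields/BalabanUV/`; imports file 1 BY NAME;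
moves nothing.  HONEST DEPENDENCY: continuum YM on T⁴ ⇐ BetaPertH ∧ nine spine estimates (0/9 proved); BetaPertH ⇐ (D1) ∧ (D4) ∧
CAP+tail; G-an2-4 gates asym, D1 and NE2/3/4.
-/

set_option autoImplicit false

open scoped BigOperators Matrix.Norms.L2Operator
open Finset

namespace Summit.QuantumFields.BalabanUV.T4Continuum.NE3FrameFreeDecompositionW

open Literature.MathematicalPhysics.QuantumFieldTheory.Balaban1983to89
open B7Prop1Explicit B7Prop2Explicit MatrixNorms
open T4AveragingDeficitWall (IsUnitaryCfg IsSkewDir SmallField Ad)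
open T4AveragingDeficitWallBoundary (IsPeriodicCfg periodBox mem_periodBox)
open T4AveragingDeficitNonAbelian (Ad_sub)
open AveragingDeficitPeriodicCounting (IsPeriodicDir)
open AveragingDeficitChartCalculus (cavg)
open AveragingDeficitMultiLevelPrep (cavgIter TangentIter tower LevelSmall)
open BlockAveragePushDirGauge (gaugeDir isPeriodicDir_gaugeDir)
open NE3TangentCovariantStructure (gaugeDir_add_fun)
open NE3TangentCovariantTower (framePotW tangentIter_add_gaugeDir_iff)
open NE3CovariantCalculus (hsR hsR_add_left hsR_sub_left hsR_self)
open NE3LandauOrbit (eq_zero_of_nhsNormSq_eq_zero gaugeDir_skew)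
open PeriodicChoice (apply_wrap_eq wrap_mem_periodBox)
open NE3CovariantBlockMean (bmeanW bmeanIterW framePotW_gaugeDir)
open NE3CurvedFrameKill (framePotW_add exists_frameFreeW_repr pow_succ_mul_eq_tower)
open NE3CurvedCornerGaugeSpace (cornerGaugeSpace₀ mem_cornerGaugeSpace₀_iff)
open AveragingDeficitMultiLevelPrep (tower_ne_zero)
open NE3FrameFreeSliceW (cornerGaugeSpaceW mem_cornerGaugeSpaceW_iff cornerGaugeSpaceW_le exists_orthogonalW_of_le
  frameFreeBlockLandauW)

noncomputable section

variable {d : ℕ} {n : Type*} [Fintype n] [DecidableEq n] [Nonempty n]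

/-! ## §12 (U_W) The trivial intersection `gaugeDir W (Ξ₀) ∩ T_♮(W) = {0}` -/

/-- **(U_W) A CORNER-TRIVIAL GAUGE DIRECTION THAT IS FRAME-FREE AND ORTHOGONAL TO `gaugeDir W (Ξ₀₀(W))` IS ZERO.**  In the class
(unitary `W` of period `tower L M (j+1)`, `0 ≤ x`, `LevelSmall d L j x`, `SmallField W x`), for a skew `tower`-periodic `μ` with
`μ ((L^(j+1))•w) = 0`: `framePotW L (j+1) W (gaugeDir W μ) = 0` forces `bmeanIterW L (j+1) W μ = 0` by the curved (‡), so `μ ∈ Ξ₀₀(W)`;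
orthogonality to its own direction then gives `Σ nhsNormSq (gaugeDir W μ) = 0`, hence `gaugeDir W μ = 0`. [folklore] -/
theorem gaugeDir_eq_zero_of_frameFree_orthogonal {L M : ℕ} [NeZero M] (hL : 1 ≤ L) (j : ℕ)
    {W : Site d → Fin d → (Matrix n n ℂ)ˣ} {x : ℝ} (hWu : IsUnitaryCfg W)
    (hWP : IsPeriodicCfg W ((tower L M (j + 1) : ℕ) : ℤ)) (hx : 0 ≤ x) (hs : LevelSmall d L j x) (hWx : SmallField W x)
    {mu : Site d → Matrix n n ℂ} (hmus : ∀ y, mu y ∈ skewAdjoint (Matrix n n ℂ))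
    (hmuP : ∀ (y : Site d) (i : Fin d), mu (y + ((tower L M (j + 1) : ℕ) : ℤ) • e i) = mu y)
    (hmu0 : ∀ w : Site d, mu (((L : ℤ) ^ (j + 1)) • w) = 0)
    (hF : ∀ z : Site d, framePotW L (j + 1) W (gaugeDir W mu) z = 0)
    (horth : ∀ ζ ∈ cornerGaugeSpaceW (d := d) (n := n) L (j + 1) W (tower L M (j + 1)) (L ^ (j + 1)),
      ∑ y ∈ periodBox (d := d) (tower L M (j + 1)), ∑ κ : Fin d, hsR (gaugeDir W mu y κ) (gaugeDir W ζ y κ) = 0) :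
    gaugeDir W mu = 0 := by
  haveI : NeZero L := ⟨by omega⟩
  have hP : 1 ≤ tower L M (j + 1) := Nat.one_le_iff_ne_zero.mpr (tower_ne_zero L M (j + 1))
  have hcast : ((L : ℤ) ^ (j + 1)) = ((L ^ (j + 1) : ℕ) : ℤ) := by push_cast; ring
  -- the nested mean of `μ` vanishes by the curved (‡)
  have hB : bmeanIterW L (j + 1) W mu = 0 := by
    funext z
    have h := framePotW_gaugeDir hL j hWu hWP hx hs hWx hmus hmuP z
    rw [hF z, hmu0 z, zero_sub] at h
    have : bmeanIterW L (j + 1) W mu z = 0 := neg_eq_zero.mp h.symm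
    simpa using this
  have hmem : mu ∈ cornerGaugeSpaceW (d := d) (n := n) L (j + 1) W (tower L M (j + 1)) (L ^ (j + 1)) :=
    mem_cornerGaugeSpaceW_iff.mpr ⟨mem_cornerGaugeSpace₀_iff.mpr ⟨hmuP, fun w => by rw [← hcast]; exact hmu0 w, hmus⟩, hB⟩
  have h := horth mu hmem
  simp only [hsR_self] at h
  have hbox : ∀ y ∈ periodBox (d := d) (tower L M (j + 1)), ∀ κ : Fin d, gaugeDir W mu y κ = 0 := by
    intro y hy κ
    have h1 := (Finset.sum_eq_zero_iff_of_nonneg fun y' _ =>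
      Finset.sum_nonneg fun ν _ => nhsNormSq_nonneg (gaugeDir W mu y' ν)).1 h y hy
    have h2 := (Finset.sum_eq_zero_iff_of_nonneg fun ν _ => nhsNormSq_nonneg (gaugeDir W mu y ν)).1 h1 κ (Finset.mem_univ κ)
    exact eq_zero_of_nhsNormSq_eq_zero h2
  have hper := isPeriodicDir_gaugeDir hWP hmuP
  funext y κ
  have hw := apply_wrap_eq (g := fun y' => gaugeDir W mu y' κ) (fun y' i => hper y' i κ) y
  rw [Pi.zero_apply, Pi.zero_apply, ← hw]
  exact hbox _ (wrap_mem_periodBox _ hP y) κ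

/-- **(U_W) AS SLICE MEMBERSHIP**: a corner-trivial skew periodic `μ` with `gaugeDir W μ ∈ frameFreeBlockLandauW L M (j+1) W` has
`gaugeDir W μ = 0` — the trivial intersection `gaugeDir W (Ξ₀) ∩ T_♮(W) = {0}`. [folklore] -/
theorem gaugeDir_eq_zero_of_mem_frameFreeBlockLandauW {L M : ℕ} [NeZero M] (hL : 1 ≤ L) (j : ℕ)
    {W : Site d → Fin d → (Matrix n n ℂ)ˣ} {x : ℝ} (hWu : IsUnitaryCfg W)
    (hWP : IsPeriodicCfg W ((tower L M (j + 1) : ℕ) : ℤ)) (hx : 0 ≤ x) (hs : LevelSmall d L j x) (hWx : SmallField W x)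
    {mu : Site d → Matrix n n ℂ} (hmus : ∀ y, mu y ∈ skewAdjoint (Matrix n n ℂ))
    (hmuP : ∀ (y : Site d) (i : Fin d), mu (y + ((tower L M (j + 1) : ℕ) : ℤ) • e i) = mu y)
    (hmu0 : ∀ w : Site d, mu (((L : ℤ) ^ (j + 1)) • w) = 0)
    (hmem : gaugeDir W mu ∈ frameFreeBlockLandauW (d := d) (n := n) L M (j + 1) W) : gaugeDir W mu = 0 :=
  gaugeDir_eq_zero_of_frameFree_orthogonal hL j hWu hWP hx hs hWx hmus hmuP hmu0 hmem.2.2.2.1 hmem.2.2.2.2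

/-! ## §13 (E_W) Existence: frame-kill, then projection onto `gaugeDir W (Ξ₀₀(W))` -/

/-- **(E_W) THE CURVED FRAME-FREE DECOMPOSITION — EXISTENCE.**  In the multi-level small-field class (unitary `W` of period
`tower L M (j+1)`, `0 ≤ x`, `LevelSmall d L j x`, `SmallField W x`; `L^d ≥ 2`), every skew `(tower L M (j+1))`-periodic direction `Y`
with `TangentIter L j W Y` has a 𝔲(n)-valued, periodic, CORNER-TRIVIAL (`μ ((L^(j+1))•w) = 0`) gauge generator `μ` with
`Y + gaugeDir W μ ∈ frameFreeBlockLandauW L M (j+1) W`.  Construction: `μ = μ₁ + η` — the curved frame-kill `μ₁` of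
`NE3CurvedFrameKill.exists_frameFreeW_repr`, then the Riesz projection `η ∈ Ξ₀₀(W)` of `NE3FrameFreeSliceW.exists_orthogonalW_of_le`;
frame-freeness survives the second step because `η ∈ Ξ₀₀(W)` (curved (‡)), tangency survives both (`tangentIter_add_gaugeDir_iff`).
The T_♮(W) twin of leaf-01-g5's `NE3CurvedProjectedLandau.exists_cornerGauge_curvedProjLandau`. [folklore] -/
theorem exists_cornerGauge_mem_frameFreeBlockLandauW {L M : ℕ} [NeZero M] (hL : 1 ≤ L) (hLd : 2 ≤ L ^ d) (j : ℕ)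
    {W : Site d → Fin d → (Matrix n n ℂ)ˣ} {x : ℝ} (hWu : IsUnitaryCfg W)
    (hWP : IsPeriodicCfg W ((tower L M (j + 1) : ℕ) : ℤ)) (hx : 0 ≤ x) (hs : LevelSmall d L j x) (hWx : SmallField W x)
    {Y : Site d → Fin d → Matrix n n ℂ} (hYs : IsSkewDir Y) (hYP : IsPeriodicDir Y ((tower L M (j + 1) : ℕ) : ℤ))
    (hYT : TangentIter L j W Y) :
    ∃ mu : Site d → Matrix n n ℂ, (∀ y, mu y ∈ skewAdjoint (Matrix n n ℂ))
      ∧ (∀ (y : Site d) (i : Fin d), mu (y + ((tower L M (j + 1) : ℕ) : ℤ) • e i) = mu y)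
      ∧ (∀ w : Site d, mu (((L : ℤ) ^ (j + 1)) • w) = 0)
      ∧ (fun y ν => Y y ν + gaugeDir W mu y ν) ∈ frameFreeBlockLandauW (d := d) (n := n) L M (j + 1) W := by
  haveI : NeZero L := ⟨by omega⟩
  have hMb : 1 ≤ L ^ (j + 1) := Nat.one_le_pow _ _ hL
  have hP : 1 ≤ tower L M (j + 1) := Nat.one_le_iff_ne_zero.mpr (tower_ne_zero L M (j + 1))
  have hcast : ((L : ℤ) ^ (j + 1)) = ((L ^ (j + 1) : ℕ) : ℤ) := by push_cast; ring
  -- Step 1: the curved frame-kill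
  obtain ⟨mu₁, hmu₁s, hmu₁P, -, hmu₁0, hF₁, hY₁s, hY₁P, hT₁⟩ := exists_frameFreeW_repr hL hLd j hWu hWP hx hs hWx hYs hYP
  set Y₁ : Site d → Fin d → Matrix n n ℂ := fun y ν => Y y ν + gaugeDir W mu₁ y ν with hY₁def
  -- Step 2: the projection onto `gaugeDir W (Ξ₀₀(W))`
  obtain ⟨η, hηmem, horth⟩ := exists_orthogonalW_of_le (d := d) (n := n) (P := tower L M (j + 1)) (M := L ^ (j + 1)) hP hMb hWP
    (cornerGaugeSpaceW (d := d) (n := n) L (j + 1) W (tower L M (j + 1)) (L ^ (j + 1)))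
    (cornerGaugeSpaceW_le L (j + 1) W (tower L M (j + 1)) (L ^ (j + 1))) Y₁
  obtain ⟨hη₀, hηB⟩ := mem_cornerGaugeSpaceW_iff.mp hηmem
  obtain ⟨hηP, hη0, hηs⟩ := mem_cornerGaugeSpace₀_iff.mp hη₀
  have hη0' : ∀ w : Site d, η (((L : ℤ) ^ (j + 1)) • w) = 0 := fun w => by rw [hcast]; exact hη0 w
  set X : Site d → Fin d → Matrix n n ℂ := fun y ν => Y₁ y ν + gaugeDir W η y ν with hXdef
  -- the total gauge
  refine ⟨fun y => mu₁ y + η y, fun y => (skewAdjoint _).add_mem (hmu₁s y) (hηs y),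
    fun y i => by simp only [hmu₁P, hηP], fun w => by simp only [hmu₁0, hη0', add_zero], ?_⟩
  have hfun : (fun y ν => Y y ν + gaugeDir W (fun y => mu₁ y + η y) y ν) = X := by
    funext y ν
    simp only [hXdef, hY₁def, gaugeDir_add_fun]
    abel
  rw [hfun]
  have hXP : IsPeriodicDir X ((tower L M (j + 1) : ℕ) : ℤ) := fun y i ν => by
    simp only [hXdef]
    rw [hY₁P y i ν, isPeriodicDir_gaugeDir hWP hηP y i ν]
  have hXs : IsSkewDir X := fun y ν => (skewAdjoint _).add_mem (hY₁s y ν) (gaugeDir_skew hWu hηs y ν)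
  refine ⟨hXs, hXP, ?_, fun z => ?_, fun ζ hζ => horth ζ hζ⟩
  · -- tangency
    show TangentIter L (j + 1 - 1) W X
    rw [Nat.add_sub_cancel]
    exact (tangentIter_add_gaugeDir_iff (M := M) hL j hWu hWP hx hs hWx Y₁ hηs hηP hη0').mpr (hT₁.mpr hYT)
  · -- frame-freeness: `η ∈ Ξ₀₀(W)` through the curved (‡)
    rw [hXdef, framePotW_add hL j hWu hx hs hWx Y₁ (gaugeDir W η) z, hF₁ z, framePotW_gaugeDir hL j hWu hWP hx hs hWx hηs hηP z,
      hη0' z, hηB]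
    simp

/-! ## §14 (D_W) Uniqueness of the decomposition -/

omit [Nonempty n] in
/-- `gaugeDir` of a difference of generators. [folklore] -/
theorem gaugeDir_sub_fun (W : Site d → Fin d → (Matrix n n ℂ)ˣ) (lam mu : Site d → Matrix n n ℂ) (z : Site d) (κ : Fin d) :
    gaugeDir W (fun y => lam y - mu y) z κ = gaugeDir W lam z κ - gaugeDir W mu z κ := by
  simp only [gaugeDir, Ad_sub]
  abel

/-- **(D_W) UNIQUENESS OF THE CURVED FRAME-FREE DECOMPOSITION**: in the class, two skew periodic corner-trivial gauges `μ₁, μ₂` that both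
move `Y` into `frameFreeBlockLandauW L M (j+1) W` have the same direction `gaugeDir W μ₁ = gaugeDir W μ₂` (hence the same slice
component) — the difference direction is frame-free and orthogonal to `gaugeDir W (Ξ₀₀(W))` by linearity, so (U_W) applies. [folklore] -/
theorem frameFreeW_decomposition_unique {L M : ℕ} [NeZero M] (hL : 1 ≤ L) (j : ℕ)
    {W : Site d → Fin d → (Matrix n n ℂ)ˣ} {x : ℝ} (hWu : IsUnitaryCfg W)
    (hWP : IsPeriodicCfg W ((tower L M (j + 1) : ℕ) : ℤ)) (hx : 0 ≤ x) (hs : LevelSmall d L j x) (hWx : SmallField W x)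
    {Y : Site d → Fin d → Matrix n n ℂ} {mu₁ mu₂ : Site d → Matrix n n ℂ}
    (h₁s : ∀ y, mu₁ y ∈ skewAdjoint (Matrix n n ℂ)) (h₂s : ∀ y, mu₂ y ∈ skewAdjoint (Matrix n n ℂ))
    (h₁P : ∀ (y : Site d) (i : Fin d), mu₁ (y + ((tower L M (j + 1) : ℕ) : ℤ) • e i) = mu₁ y)
    (h₂P : ∀ (y : Site d) (i : Fin d), mu₂ (y + ((tower L M (j + 1) : ℕ) : ℤ) • e i) = mu₂ y)
    (h₁0 : ∀ w : Site d, mu₁ (((L : ℤ) ^ (j + 1)) • w) = 0) (h₂0 : ∀ w : Site d, mu₂ (((L : ℤ) ^ (j + 1)) • w) = 0)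
    (hX₁ : (fun y ν => Y y ν + gaugeDir W mu₁ y ν) ∈ frameFreeBlockLandauW (d := d) (n := n) L M (j + 1) W)
    (hX₂ : (fun y ν => Y y ν + gaugeDir W mu₂ y ν) ∈ frameFreeBlockLandauW (d := d) (n := n) L M (j + 1) W) :
    gaugeDir W mu₁ = gaugeDir W mu₂ := by
  set δ : Site d → Matrix n n ℂ := fun y => mu₁ y - mu₂ y with hδdef
  have hδs : ∀ y, δ y ∈ skewAdjoint (Matrix n n ℂ) := fun y => (skewAdjoint _).sub_mem (h₁s y) (h₂s y)
  have hδP : ∀ (y : Site d) (i : Fin d), δ (y + ((tower L M (j + 1) : ℕ) : ℤ) • e i) = δ y := fun y i => by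
    simp only [hδdef, h₁P, h₂P]
  have hδ0 : ∀ w : Site d, δ (((L : ℤ) ^ (j + 1)) • w) = 0 := fun w => by simp only [hδdef, h₁0, h₂0, sub_self]
  have hgd : ∀ (y : Site d) (κ : Fin d), gaugeDir W δ y κ
      = (Y y κ + gaugeDir W mu₁ y κ) - (Y y κ + gaugeDir W mu₂ y κ) := fun y κ => by
    rw [hδdef, gaugeDir_sub_fun]; abel
  -- frame-freeness of the difference: additivity of the accumulated frames
  have hF : ∀ z : Site d, framePotW L (j + 1) W (gaugeDir W δ) z = 0 := by
    intro z
    have hsum : (fun y ν => (fun y ν => Y y ν + gaugeDir W mu₂ y ν) y ν + gaugeDir W δ y ν)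
        = fun y ν => Y y ν + gaugeDir W mu₁ y ν := by
      funext y ν; rw [hgd, add_sub_cancel]
    have h := framePotW_add hL j hWu hx hs hWx (fun y ν => Y y ν + gaugeDir W mu₂ y ν) (gaugeDir W δ) z
    rw [hsum, hX₁.2.2.2.1 z, hX₂.2.2.2.1 z, zero_add] at h
    exact h.symm
  -- orthogonality of the difference
  have horth : ∀ ζ ∈ cornerGaugeSpaceW (d := d) (n := n) L (j + 1) W (tower L M (j + 1)) (L ^ (j + 1)),
      ∑ y ∈ periodBox (d := d) (tower L M (j + 1)), ∑ κ : Fin d, hsR (gaugeDir W δ y κ) (gaugeDir W ζ y κ) = 0 := by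
    intro ζ hζ
    have e1 := hX₁.2.2.2.2 ζ hζ
    have e2 := hX₂.2.2.2.2 ζ hζ
    simp_rw [hgd, hsR_sub_left, Finset.sum_sub_distrib]
    rw [e1, e2, sub_self]
  have h0 := gaugeDir_eq_zero_of_frameFree_orthogonal hL j hWu hWP hx hs hWx hδs hδP hδ0 hF horth
  funext y κ
  have := congr_fun (congr_fun h0 y) κ
  rw [hgd, Pi.zero_apply, Pi.zero_apply] at this
  have h' : gaugeDir W mu₁ y κ - gaugeDir W mu₂ y κ = 0 := by rw [← this]; abel
  exact sub_eq_zero.mp h'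

end

end Summit.QuantumFields.BalabanUV.T4Continuum.NE3FrameFreeDecompositionW
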